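import Literature.Topology.Immersions.TriplePointsGenericity
import Literature.Topology.Immersions.DoublePointManifold
import HarnessLib

/-!
# Triple points of a generic immersion are finite (`3 dim M = 2q`, e.g. `M⁴ ↬ ℝ⁶`)

Topic `Literature/Topology/Immersions`. For a `C^∞` immersion `f : M → ℝ^q` of a compact
`n`-manifold with `n + n + n = q + q` whose triple points are transverse
(`TriplePointsGenericity.lean`, `GenericImmersionPerturbation.lean`), the set of ordered
triple points

  `T(f) = {(x, y, z) pairwise distinct | f x = f y = f z} ⊆ M × M × M`

is **finite** (Kirby, *The Topology of 4-Manifolds* (1989), Ch. VI p. 40: the triple points of a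
generic `M⁴ ↬ ℝ⁶` are isolated and counted with signs; Hirsch (1976), Ch. 3 §2 Ex. 2: in general
position the `k`-fold points form a manifold of dimension `kn - (k-1)q`, here `0`). Proof:
`T(f)` is closed — it keeps off the fat diagonal by the injectivity of `f` near the diagonal
(`exists_isOpen_diagonal_injOn`) — hence compact, and each of its points is isolated because the
map `(x, y, z) ↦ (f x - f y, f y - f z)` has onto, hence (equal dimensions) injective,
differential there and is therefore injective nearby (Hirsch Ch. 2 §1 Lemma 1.3,
`Literature.Geometry.Manifold.exists_isOpen_eventually_injOn_and_injective_mfderiv`).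

* `finite_triplePoints`.

Everything here is proved; no definitions, no named facts.

## References

* R. C. Kirby, *The Topology of 4-Manifolds*, LNM 1374 (1989), Ch. VI, p. 40. [Kirby1989]
* M. W. Hirsch, *Differential Topology*, GTM 33 (1976), Ch. 2 §1 Lemma 1.3, Ch. 3 §2 Ex. 2.
  [HirschDT1976]
-/

open scoped Manifold ContDiff Topology
open Set Function Module

noncomputable section

universe u

namespace Literature.Topology.Immersions

/-- Local notation: `𝔼 n` is the model Euclidean space `EuclideanSpace ℝ (Fin n)`. -/
local notation "𝔼 " n:arg => EuclideanSpace ℝ (Fin n)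

open Literature.Geometry.Manifold (exists_isOpen_eventually_injOn_and_injective_mfderiv)

variable {n q : ℕ} {M : Type u} [TopologicalSpace M] [ChartedSpace (𝔼 n) M]
  [CompactSpace M] [IsManifold (𝓡 n) ∞ M]

/-- **The triple points of a generic immersion are finite** (`n + n + n = q + q`). For a `C^∞`
immersion `f : M → ℝ^q` of a compact manifold all of whose triple points are transverse, the
set of pairwise distinct `(x, y, z)` with `f x = f y = f z` is finite.
[cite: Kirby1989, Ch. VI p. 40; HirschDT1976, Ch. 3 §2 Ex. 2] -/
theorem finite_triplePoints (hdim : n + (n + n) = q + q) {f : M → 𝔼 q}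
    (hf : ContMDiff (𝓡 n) (𝓡 q) ∞ f) (himm : ∀ x, Injective (mfderiv (𝓡 n) (𝓡 q) f x))
    (htp : ∀ x y z : M, x ≠ y → y ≠ z → x ≠ z → f x = f y → f y = f z →
      ∀ W : 𝔼 q × 𝔼 q, ∃ ζ : 𝔼 n × 𝔼 n × 𝔼 n,
        (ediff n q f x ζ.1 - ediff n q f y ζ.2.1, ediff n q f y ζ.2.1 - ediff n q f z ζ.2.2) = W) :
    Set.Finite {p : M × M × M | p.1 ≠ p.2.1 ∧ p.2.1 ≠ p.2.2 ∧ p.1 ≠ p.2.2 ∧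
      f p.1 = f p.2.1 ∧ f p.2.1 = f p.2.2} := by
  set T : Set (M × M × M) := {p | p.1 ≠ p.2.1 ∧ p.2.1 ≠ p.2.2 ∧ p.1 ≠ p.2.2 ∧
    f p.1 = f p.2.1 ∧ f p.2.1 = f p.2.2} with hT
  -- Step 1: `T` is closed, hence compact
  obtain ⟨O, hOo, hdiag, hOinj⟩ := exists_isOpen_diagonal_injOn hf himm
  have hc1 : Continuous fun p : M × M × M => p.1 := continuous_fst
  have hc2 : Continuous fun p : M × M × M => p.2.1 := continuous_fst.comp continuous_snd
  have hc3 : Continuous fun p : M × M × M => p.2.2 := continuous_snd.comp continuous_snd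
  have hTeq : T = ({p | f p.1 = f p.2.1} ∩ {p | f p.2.1 = f p.2.2}) ∩
      (((fun p : M × M × M => (p.1, p.2.1)) ⁻¹' O ∪ (fun p => (p.2.1, p.2.2)) ⁻¹' O ∪
        (fun p => (p.1, p.2.2)) ⁻¹' O)ᶜ) := by
    ext p
    simp only [hT, mem_setOf_eq, mem_inter_iff, mem_compl_iff, mem_union, mem_preimage, not_or]
    constructor
    · rintro ⟨h12, h23, h13, e12, e23⟩
      exact ⟨⟨e12, e23⟩, ⟨fun hO => h12 (hOinj _ hO e12), fun hO => h23 (hOinj _ hO e23)⟩,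
        fun hO => h13 (hOinj _ hO (e12.trans e23))⟩
    · rintro ⟨⟨e12, e23⟩, ⟨n12, n23⟩, n13⟩
      exact ⟨fun h => n12 (hdiag (mem_diagonal_iff.2 h)), fun h => n23 (hdiag (mem_diagonal_iff.2 h)),
        fun h => n13 (hdiag (mem_diagonal_iff.2 h)), e12, e23⟩
  have hTc : IsClosed T := by
    rw [hTeq]
    refine ((isClosed_eq (hf.continuous.comp hc1) (hf.continuous.comp hc2)).inter
      (isClosed_eq (hf.continuous.comp hc2) (hf.continuous.comp hc3))).inter ?_
    exact (((hOo.preimage (hc1.prodMk hc2)).union (hOo.preimage (hc2.prodMk hc3))).union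
      (hOo.preimage (hc1.prodMk hc3))).isClosed_compl
  have hTK : IsCompact T := hTc.isCompact
  -- Step 2: each triple point is isolated, by local injectivity of `G = (f x - f y, f y - f z)`
  let Lq : (𝔼 q × 𝔼 q) ≃L[ℝ] 𝔼 (q + q) := ContinuousLinearEquiv.ofFinrankEq finrank_prod_self_eq
  let L₁ : 𝔼 q →L[ℝ] 𝔼 (q + q) :=
    (Lq : (𝔼 q × 𝔼 q) →L[ℝ] 𝔼 (q + q)).comp (ContinuousLinearMap.inl ℝ (𝔼 q) (𝔼 q))
  let L₂ : 𝔼 q →L[ℝ] 𝔼 (q + q) :=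
    (Lq : (𝔼 q × 𝔼 q) →L[ℝ] 𝔼 (q + q)).comp (ContinuousLinearMap.inr ℝ (𝔼 q) (𝔼 q))
  have hL12 : ∀ a c : 𝔼 q, L₁ a + L₂ c = Lq (a, c) := fun a c => by
    show Lq (a, 0) + Lq (0, c) = Lq (a, c)
    rw [← map_add, Prod.mk_add_mk, add_zero, zero_add]
  let I₃ := (𝓡 n).prod ((𝓡 n).prod (𝓡 n))
  let G : M × M × M → 𝔼 (q + q) := fun p => L₁ (f p.1 - f p.2.1) + L₂ (f p.2.1 - f p.2.2)
  have hfd : ∀ x, MDifferentiableAt (𝓡 n) (𝓡 q) f x := fun x => (hf x).mdifferentiableAt (by simp)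
  have hG : ContMDiff I₃ (𝓡 (q + q)) ∞ G :=
    (L₁.contDiff.comp_contMDiff ((hf.comp contMDiff_fst).sub (hf.comp (contMDiff_fst.comp contMDiff_snd)))).add
      (L₂.contDiff.comp_contMDiff ((hf.comp (contMDiff_fst.comp contMDiff_snd)).sub
        (hf.comp (contMDiff_snd.comp contMDiff_snd))))
  have hiso : ∀ p ∈ T, ∃ N : Set (M × M × M), IsOpen N ∧ p ∈ N ∧ ∀ p' ∈ N, p' ∈ T → p' = p := by
    rintro ⟨x, y, z⟩ ⟨h12, h23, h13, e12, e23⟩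
    -- `dG` is onto, hence injective (equal dimensions)
    have hsurjG : Surjective (mfderiv I₃ (𝓡 (q + q)) G (x, y, z)) := by
      intro w
      obtain ⟨ζ, hζ⟩ := htp x y z h12 h23 h13 e12 e23 (Lq.symm w)
      refine ⟨ζ, ?_⟩
      rw [mfderiv_triple_apply hfd L₁ L₂ x y z ζ, hL12]
      have hζ' : (ediff n q f x ζ.1 - ediff n q f y ζ.2.1, ediff n q f y ζ.2.1 - ediff n q f z ζ.2.2) =
          Lq.symm w := hζ
      rw [hζ', ContinuousLinearEquiv.apply_symm_apply]
    have hinjG : Injective (mfderiv I₃ (𝓡 (q + q)) G (x, y, z)) := by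
      obtain ⟨A, hA, hAi⟩ : ∃ A : (𝔼 n × (𝔼 n × 𝔼 n)) →ₗ[ℝ] 𝔼 (q + q), Surjective A ∧
          (Injective A → Injective (mfderiv I₃ (𝓡 (q + q)) G (x, y, z))) :=
        ⟨(mfderiv I₃ (𝓡 (q + q)) G (x, y, z)).toLinearMap, hsurjG, fun h => h⟩
      refine hAi ((LinearMap.injective_iff_surjective_of_finrank_eq_finrank ?_).2 hA)
      simp [Module.finrank_prod, hdim]
    -- local injectivity (constant family over the parameter line)
    have hΦ : ContMDiffOn (𝓘(ℝ, ℝ).prod I₃) 𝓘(ℝ, 𝔼 (q + q)) ∞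
        (uncurry fun (_ : ℝ) (p : M × M × M) => G p) ((univ : Set ℝ) ×ˢ (univ : Set (M × M × M))) :=
      (hG.comp contMDiff_snd).contMDiffOn
    obtain ⟨N, hNo, hpN, hev⟩ := exists_isOpen_eventually_injOn_and_injective_mfderiv
      (J := 𝓘(ℝ, ℝ)) (I := I₃) (n := ∞) isOpen_univ hΦ (by simp) (mem_univ (0 : ℝ)) (x, y, z) hinjG
    have hinjN : InjOn G N := (hev.self_of_nhds).1
    refine ⟨N, hNo, hpN, fun p' hp' hp'T => hinjN hp' hpN ?_⟩
    obtain ⟨-, -, -, e12', e23'⟩ := hp'T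
    show L₁ (f p'.1 - f p'.2.1) + L₂ (f p'.2.1 - f p'.2.2) = L₁ (f x - f y) + L₂ (f y - f z)
    rw [e12', e23', e12, e23, sub_self, sub_self]
  -- Step 3: compact with isolated points, hence finite
  choose! N hNo hpN hNuniq using hiso
  obtain ⟨F, hFT, hFfin, hcover⟩ := hTK.elim_finite_subcover_image (b := T) (c := N)
    (fun p hp => hNo p hp) (fun p hp => mem_biUnion hp (hpN p hp))
  refine hFfin.subset fun p hp => ?_
  obtain ⟨p₀, hp₀F, hpp₀⟩ := mem_iUnion₂.1 (hcover hp)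
  rw [hNuniq p₀ (hFT hp₀F) p hpp₀ hp]
  exact hp₀F

end Literature.Topology.Immersions
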